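import Summits.AtomisticToContinuum.FouriersLaw.Theses.HonestZwanzig

/-!
# `HonestZwanzig.MemoryConductivity` — what the item is, formally
(support for stmt-AtomisticToContinuum-12700)

The support item `MemoryConductivity` of route `HonestZwanzig` (sub-problem `FouriersLaw`) says: for
`pinnedChain ω₂ lam β γ` (all parameters `> 0`) and every `T > 0` there is `k > 0` with
`(∫₀^∞ corr(J,J)_N) / (N - 1) → k` as `N → ∞`, where `corr(J,J)_N(t) = ∫ J · (P_t J) dμ_{N,T} - μ_{N,T}(J)²`
is the equilibrium autocorrelation of the total current `J = Σ_b j_b` of the `N`-chain with both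
Langevin baths at temperature `T` (`gibbsMeasure`, `transitionKernel`).

This file records, sorry-free, the exact logical position of the item:

* `HonestZwanzig.memoryConductivity_of_networkReduction` — IN the route it has no content of its own:
  it is the one-line composition of the reduction item `NetworkReduction` with its six antecedents
  (`GeneratorSiteEnergy`, `ParityStatics`, `FeshbachIdentities`, `OrthogonalOhm`, `PositiveMemory`,
  `RobinCoercivity`), exactly as the route's deciding theorem `closes` obtains it (it is not a
  hypothesis of `closes`).
* `HonestZwanzig.nessUnique_of_fouriersLaw` — clause (i) of the sub-problem statement gives the
  shared item `NessUnique`.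
* `HonestZwanzig.memoryConductivity_of_fouriersLaw` — the CONVERSE of the route's last step: given the
  Kundu–Dhar–Narayan open-chain Green–Kubo identity (item `OpenChainGreenKubo`), the sub-problem
  statement `FouriersLaw` implies `MemoryConductivity` with `k = κ(T) · T²` (uniqueness of the
  `δ`-limits identifies `D_N` with `∫₀^∞corr(J,J)/((N-1)T²)` for `N ≥ 2`).
* `HonestZwanzig.fouriersLaw_of_memoryConductivity` and `HonestZwanzig.fouriersLaw_iff` — hence,
  modulo `OpenChainGreenKubo`, `FouriersLaw ↔ NessUnique ∧ MemoryConductivity`: STANDALONE the item is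
  clause (ii) of Fourier's law for the pinned anharmonic chain in correlation form, the open problem of
  Bonetto–Lebowitz–Rey-Bellet (2000), §5.3 eq. (33) — not a routine support statement.

Every theorem here is an implication between route decls / the sub-problem statement; nothing is
closed and no statement is restated. All antecedents are OPEN ledger items as of 2026-08-16.
-/

namespace Summit.AtomisticToContinuum.FouriersLaw.Theorems

open Summit.AtomisticToContinuum.FouriersLaw.Theses
open MeasureTheory Filter Topology

/-- In-route closing composition (verbatim the first line of `Theses.HonestZwanzig.closes`):
`NetworkReduction` applied to its six antecedents is `MemoryConductivity`. Conditional on seven open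
items (12701; 12698, 12699, 12697, 12693, 12694, 12695). [folklore] -/
theorem HonestZwanzig.memoryConductivity_of_networkReduction
    (hNR : HonestZwanzig.NetworkReduction) (hGSE : HonestZwanzig.GeneratorSiteEnergy)
    (hPS : HonestZwanzig.ParityStatics) (hFI : HonestZwanzig.FeshbachIdentities)
    (hOO : HonestZwanzig.OrthogonalOhm) (hPM : HonestZwanzig.PositiveMemory)
    (hRC : HonestZwanzig.RobinCoercivity) : HonestZwanzig.MemoryConductivity :=
  hNR hGSE hPS hFI hOO hPM hRC

/-- Clause (i) of `FouriersLaw` (existence AND uniqueness of the weak steady state of `pinnedChain`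
for all `N`, `T_L, T_R > 0`) gives the shared uniqueness item `NessUnique`
(stmt-AtomisticToContinuum-0741) — any two steady states both equal the distinguished one. [folklore] -/
theorem HonestZwanzig.nessUnique_of_fouriersLaw (h : _root_.FouriersLaw) :
    HonestZwanzig.NessUnique := by
  intro ω₂ lam β γ hω hl hβ hγ N T_L T_R hL hR μ ν hμ hν
  obtain ⟨μ₀, -, huniq⟩ := (h ω₂ lam β γ hω hl hβ hγ).1 N T_L T_R hL hR
  rw [huniq μ hμ, huniq ν hν]

/-- **The item is necessary.** Given the open-chain Green–Kubo identity `OpenChainGreenKubo`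
(Kundu–Dhar–Narayan 2009: for `N ≥ 2` the clause-(ii) response limit equals
`∫₀^∞corr(J,J)/((N-1)T²)`), the sub-problem statement `FouriersLaw` implies `MemoryConductivity`
with `k = κ(T) · T²`: clause (i) supplies weak-NESS uniqueness and (by choice) a steady-state family,
clause (ii) a response sequence `D_N → κ(T)`, and uniqueness of limits along `𝓝[≠] 0` identifies
`D_N · T² = ∫₀^∞corr(J,J)/(N-1)` for `N ≥ 2`. [folklore] -/
theorem HonestZwanzig.memoryConductivity_of_fouriersLaw (hGK : HonestZwanzig.OpenChainGreenKubo)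
    (hFL : _root_.FouriersLaw) : HonestZwanzig.MemoryConductivity := by
  classical
  intro ω₂ lam β γ hω hl hβ hγ T hT
  obtain ⟨hex, κ, hκ, hresp⟩ := hFL ω₂ lam β γ hω hl hβ hγ
  have huniq := HonestZwanzig.nessUnique_of_fouriersLaw hFL ω₂ lam β γ hω hl hβ hγ
  -- a steady-state family, by choice from clause (i)
  let μf : (N : ℕ) → ℝ → ℝ →
      Measure (Literature.MathematicalPhysics.KineticTheory.HeatConduction.PhaseSpace N) :=
    fun N T_L T_R => if h : 0 < T_L ∧ 0 < T_R then Classical.choose (hex N T_L T_R h.1 h.2) else 0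
  have hμf : ∀ (N : ℕ) (T_L T_R : ℝ), 0 < T_L → 0 < T_R →
      (Literature.MathematicalPhysics.KineticTheory.HeatConduction.pinnedChain ω₂ lam β γ).IsSteadyState
        N T_L T_R (μf N T_L T_R) := by
    intro N T_L T_R hL hR
    simp only [μf, dif_pos (And.intro hL hR)]
    exact (Classical.choose_spec (hex N T_L T_R hL hR)).1
  obtain ⟨D, hD, hDκ⟩ := hresp μf hμf T hT
  refine ⟨κ T * T ^ 2, mul_pos (hκ T hT) (pow_pos hT 2), ?_⟩
  have hlim : Tendsto (fun N : ℕ => D N * T ^ 2) atTop (𝓝 (κ T * T ^ 2)) := hDκ.mul_const _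
  refine hlim.congr' ?_
  filter_upwards [Filter.eventually_ge_atTop 2] with N hN
  have h2 := (hGK ω₂ lam β γ hω hl hβ hγ huniq μf hμf T hT N hN).2
  have hDN := tendsto_nhds_unique (hD N) h2
  rw [hDN]
  dsimp only
  rw [div_mul_eq_mul_div, mul_div_mul_right _ _ (pow_ne_zero 2 hT.ne')]

/-- **The item is sufficient (with uniqueness and the Green–Kubo identity).** This is the body of the
route's deciding theorem `Theses.HonestZwanzig.closes` after its first line, with
`MemoryConductivity` taken as a hypothesis instead of being produced by `NetworkReduction`:
clause (i) from the proved existence fact `pinnedChain_exists_isSteadyState`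
(Cuneo–Eckmann–Hairer–Rey-Bellet 2018, Thm 2.13) plus `NessUnique`; clause (ii) with
`κ T := k(T)/T²`, `D_N := (∫₀^∞corr(J,J)/(N-1))/T²` for `N ≥ 2` (its `δ`-limit is
`OpenChainGreenKubo`) and `D_N := 0` for `N ≤ 1` (no bond, no current). [folklore] -/
theorem HonestZwanzig.fouriersLaw_of_memoryConductivity (hNU : HonestZwanzig.NessUnique)
    (hGK : HonestZwanzig.OpenChainGreenKubo) (hMC : HonestZwanzig.MemoryConductivity) :
    _root_.FouriersLaw := by
  intro ω₂ lam β γ hω hl hβ hγ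
  have huniq := hNU ω₂ lam β γ hω hl hβ hγ
  refine ⟨?_, ?_⟩
  · -- clause (i): existence (landed theorem, all N) + uniqueness (item NessUnique)
    intro N T_L T_R hL hR
    obtain ⟨μ, hμ⟩ :=
      Literature.MathematicalPhysics.KineticTheory.HeatConduction.pinnedChain_exists_isSteadyState
        hω hl hβ hγ N hL hR
    exact ⟨μ, hμ, fun ν hν => huniq N T_L T_R hL hR ν μ hν hμ⟩
  · -- clause (ii)
    classical
    have hk : ∀ T : ℝ, 0 < T → ∃ k : ℝ, 0 < k ∧ Filter.Tendsto (fun N : ℕ =>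
        (let P := Literature.MathematicalPhysics.KineticTheory.HeatConduction.pinnedChain ω₂ lam β γ
         let X := Literature.MathematicalPhysics.KineticTheory.HeatConduction.PhaseSpace N
         let μ : MeasureTheory.Measure X := P.gibbsMeasure N T
         let J : X → ℝ := fun z => ∑ i : Fin N, P.bondCurrent N i z
         (∫ t in Set.Ioi (0 : ℝ), ((∫ z, J z * (∫ y, J y ∂(P.transitionKernel N T T t.toNNReal z)) ∂μ) -
            (∫ z, J z ∂μ) * (∫ z, J z ∂μ))) / ((N : ℝ) - 1))) Filter.atTop (nhds k) :=
      fun T hT => hMC ω₂ lam β γ hω hl hβ hγ T hT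
    refine ⟨fun T => if hT : 0 < T then Classical.choose (hk T hT) / T ^ 2 else 1, ?_, ?_⟩
    · intro T hT
      simp only [dif_pos hT]
      exact div_pos (Classical.choose_spec (hk T hT)).1 (pow_pos hT 2)
    · intro μf hμf T hT
      obtain ⟨-, hlim⟩ := Classical.choose_spec (hk T hT)
      -- no bond, no current: chains of length ≤ 1
      have htc0 : ∀ N : ℕ, N < 2 →
          ∀ ν : MeasureTheory.Measure (Literature.MathematicalPhysics.KineticTheory.HeatConduction.PhaseSpace N),
            (Literature.MathematicalPhysics.KineticTheory.HeatConduction.pinnedChain ω₂ lam β γ).totalCurrent ν = 0 := by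
        intro N hN ν
        unfold Literature.MathematicalPhysics.KineticTheory.HeatConduction.OscillatorChain.totalCurrent
        refine Finset.sum_eq_zero fun i _ => ?_
        have hz : (Literature.MathematicalPhysics.KineticTheory.HeatConduction.pinnedChain ω₂ lam β γ).bondCurrent N i =
            fun _ => 0 := by
          funext z
          unfold Literature.MathematicalPhysics.KineticTheory.HeatConduction.OscillatorChain.bondCurrent
          refine Finset.sum_eq_zero fun j _ => ?_
          have hj := j.isLt
          have hi := i.isLt
          rw [if_neg (by omega)]
        rw [hz, MeasureTheory.integral_zero]
      -- the response coefficients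
      let F : ℕ → ℝ := fun N =>
        (let P := Literature.MathematicalPhysics.KineticTheory.HeatConduction.pinnedChain ω₂ lam β γ
         let X := Literature.MathematicalPhysics.KineticTheory.HeatConduction.PhaseSpace N
         let μ : MeasureTheory.Measure X := P.gibbsMeasure N T
         let J : X → ℝ := fun z => ∑ i : Fin N, P.bondCurrent N i z
         (∫ t in Set.Ioi (0 : ℝ), ((∫ z, J z * (∫ y, J y ∂(P.transitionKernel N T T t.toNNReal z)) ∂μ) -
            (∫ z, J z ∂μ) * (∫ z, J z ∂μ))) / ((N : ℝ) - 1))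
      have hF : Filter.Tendsto F Filter.atTop (nhds (Classical.choose (hk T hT))) := hlim
      let D : ℕ → ℝ := fun N => if 2 ≤ N then F N / T ^ 2 else 0
      refine ⟨D, fun N => ?_, ?_⟩
      · by_cases hN : 2 ≤ N
        · -- N ≥ 2: the Kundu–Dhar–Narayan identity (item OpenChainGreenKubo, fed NessUnique)
          have h2 := (hGK ω₂ lam β γ hω hl hβ hγ huniq μf hμf T hT N hN).2
          have hDN : D N = F N / T ^ 2 := by simp only [D, if_pos hN]
          rw [hDN]
          convert h2 using 2
          simp only [F]
          rw [div_div]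
        · have hN' : N < 2 := Nat.lt_of_not_le hN
          have hDN : D N = 0 := by simp only [D, if_neg hN]
          rw [hDN]
          have hfun : (fun δ : ℝ =>
              (Literature.MathematicalPhysics.KineticTheory.HeatConduction.pinnedChain ω₂ lam β γ).totalCurrent
                (μf N (T + δ / 2) (T - δ / 2)) / δ) = fun _ => 0 := by
            funext δ
            rw [htc0 N hN', zero_div]
          rw [hfun]
          exact tendsto_const_nhds
      · simp only [dif_pos hT]
        have hev : (fun N => F N / T ^ 2) =ᶠ[Filter.atTop] D :=
          Filter.eventually_atTop.2 ⟨2, fun N hN => by simp only [D, if_pos hN]⟩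
        exact (hF.div_const (T ^ 2)).congr' hev

/-- **Standalone, the item is Fourier's law.** Modulo the Kundu–Dhar–Narayan identity
`OpenChainGreenKubo`, the sub-problem statement `FouriersLaw` (Bonetto–Lebowitz–Rey-Bellet 2000,
§5.3 eq. (33), for `pinnedChain`) is EQUIVALENT to weak-NESS uniqueness together with
`MemoryConductivity`; in particular a standalone proof of stmt-AtomisticToContinuum-12700 is a proof
of clause (ii) of the conjunct — the open problem itself. [folklore] -/
theorem HonestZwanzig.fouriersLaw_iff (hGK : HonestZwanzig.OpenChainGreenKubo) :
    _root_.FouriersLaw ↔ HonestZwanzig.NessUnique ∧ HonestZwanzig.MemoryConductivity :=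
  ⟨fun h => ⟨HonestZwanzig.nessUnique_of_fouriersLaw h,
    HonestZwanzig.memoryConductivity_of_fouriersLaw hGK h⟩,
    fun h => HonestZwanzig.fouriersLaw_of_memoryConductivity h.1 hGK h.2⟩

end Summit.AtomisticToContinuum.FouriersLaw.Theorems
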